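import Summits.BirchSwinnertonDyer.Rank1Residual.X6.RankZeroCertificateClaimResidualErrOdd
import Summits.BirchSwinnertonDyer.Rank1Residual.X6.RankZeroCertificateClaimResidualPair
import Summits.BirchSwinnertonDyer.Rank1Residual.X6.RankZeroCertificateInertPairCoprime
import Summits.BirchSwinnertonDyer.BirchSwinnertonDyer.Theorems.PrintX6EisensteinHalfFiveLeRestPairGuard
import HarnessLib

/-!
# Class X6 ∧ analytic rank `0` — ty2's `HasInertPairPrimeToUnits` DECIDED per record, and `BSD(E,p)` for every NARROWED-PAIR
# certificate record BY NAME over the route's pack and the GUARDED pair pack (PLAN v4.8b (β), road (I) with the printed rider):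
# 103 records; with the odd-erratum road, 111 of the 113 records at `p ≥ 5`; the refined residual sits on `246697a1, 321518d1 @ 5`

Cell `bsd-print-x6` (D-0131 (2) print tier, key `x6`; HOME `run/shared/lean/pub/bsd-print-x6/`), typer seat ty3 (gen 7).
Twin of `RankZeroCertificateClaimResidualPair.lean` (p577647: the UN-NARROWED pair road over `PublishedAcInputsX6Pair`, HELD) for the
refined key of PLAN v4.8b / referee R-5.3: prover p1's (β2) `AnticyclotomicRankZero.eisensteinHalfFiveLe_inertPairGuard_of_facts` /
`eisensteinHalfFiveLeRestPairGuard_of_facts : PublishedAcInputsX6PairGuard → ∀ W p, ¬CM → 5 ≤ p → ClassX6 W p → r_an = 0 →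
¬ HasErratumPrime W p → HasInertPairPrimeToUnits W p → (E₅ body)` (p579270), ty2's (β1) `HasInertPairPrimeToUnits` /
`PublishedAcInputsX6PairGuard` (p578797; hSh′ = CW24 Thm 5.3 / JSW17 with the printed rider `p ∤ ℓ² − 1` on the inert primes, p577910),
and ty3's certificate `Record.inertPairCoprimeAt` (p574374: `HasInertPair`'s body ∧ `¬ p ∣ (ℓ₁²−1)(ℓ₂²−1)`, 103/113 at `p ≥ 5`) —
composed with the odd-erratum display `RankZeroCertificateClaimResidualErrOdd.lean` for the census union. PARTITION (D-0054): leaf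
X6 ∧ r = 0 (K3 row A6) — types-the-object-of; closes NONE.

HONEST FRAMING: BSD is not proved here for any class or curve outright. Every `BSD(E,p)` below is per pair and CONDITIONAL, by
name, on the route's input conjunction `PublishedInputsX6` (stmt-BirchSwinnertonDyer-20302) and on ty2's guarded pack
`Supersingular.PublishedAcInputsX6PairGuard` (nine NAMED published facts; tier = the cell referee's β3 word) — for the union
theorems also on the repaired Err pack `PublishedAcInputsX6ErrOdd` (referee A-2: PRINT-by-name) — and on the record's CLAIM
(`r_an = 0`) or an explicit `r_an = 0` / enclosure line. `ClassX6`, `HasInertPairPrimeToUnits`, `HasOddErratumPrime`,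
`Fact p.Prime`, `IsElliptic`, `IsGloballyMinimal` are KERNEL theorems from the recheck. BSTW arXiv:2409.01350 is NOT used.

WHAT THE DISPLAY SAYS:
* §0 the Named bridge (pattern p564740): `Record.hasInertPairPrimeToUnits_of_check` / `not_…` (ty2's body IS p574374's structural
  statement), `hasInertPairPrimeToUnits_iff_of_mem` (decided on the display), adapters, the keepers / losers by name.
* §1 pair level: `PublishedInputsX6 → PublishedAcInputsX6PairGuard → 5 ≤ p → ClassX6 → r_an = 0 → HasInertPairPrimeToUnits →
  BSD(E,p)` (destructure pack and witness; upper half = the route's PROVED `UpperHalfX6`; lower half = p1's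
  `eisensteinHalfFiveLe_inertPairGuard_of_facts`; p2's socket composition; no `HasErratumPrime` case split).
* §2 per record `Record.bsdp_of_inertPairCoprimeAt` (claim) / `…_of_LOneBall` (claim-free); §3 census `bsdp_of_mem_inertPairCoprimeAt`
  (**103 records at `p ≥ 5`**), the UNION with the odd-erratum road `bsdp_of_mem_five_le_of_label_ne` (**every record at `p ≥ 5`
  other than `246697a1, 321518d1 @ 5` — 111 of 113 — gets `BSD(E,p)` by name over `PublishedInputsX6 ∧ PublishedAcInputsX6ErrOdd ∧
  PublishedAcInputsX6PairGuard`, no open crux**), and the refined residual's hypotheses MET at exactly those two records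
  (`restThinGuard_hyps_cell_246697a1_at5` / `_321518d1_at5`: `¬ HasErratumPrime ∧ ¬ HasInertPairPrimeToUnits`, kernel).
* §4 `hWeq` adapters and cells by name over the guarded pack: the four Rest keepers `138594b1, 331554a1 @ 5`, `12927e1, 399190l1 @ 7`,
  the four `q = 2`-only Err records (reached by this road but not by the odd-erratum one), and the T3 witness cell `22678e1 @ 5`.

Two engines: HOME/ty3/inertpair/X6R0-INERTPAIR-UNITCONJ-v2.tsv and the kernel. beyond-print theorem: NO (bookkeeping; the beyond-print
content is road (I)'s, p579270). References: Kobayashi 2003 Thm. 1.2 / 4.1 [Kobayashi2003]; B. D. Kim 2013 Cor. 3.15 [BDKim2013];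
Castella–Wan 2024 Thm. 5.3, Prop. 2.7 [CastellaWan2023]; Jetchev–Skinner–Wan 2017 §5.1.2 (C(f,ψ)) [JetchevSkinnerWan2017]; Brooks 2015
Thm. 8.2 [Brooks2015IMRN]; Miller 2011 Def. 1.1 [Miller2011LMS]; Silverman *AEC* VII.5 Prop. 5.1 [SilvermanAEC2009]; [BirchSwinnertonDyer1965];
[MazurTateTeitelbaum1986Invent] §I.8; Cremona's tables [Cremona2006]; HOME/PLAN.md v4.8b, HOME/REFEREE.md R-5.3.
-/

set_option autoImplicit false

open scoped MatrixGroups ModularForm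
open CongruenceSubgroup WeierstrassCurve Literature.NumberTheory.EllipticCurves Literature.NumberTheory.EllipticCurves.ModularForms
  Literature.NumberTheory.EllipticCurves.Rank1Residual Literature.NumberTheory.EllipticCurves.Rank1Residual.Typed
open Summit.BirchSwinnertonDyer.BirchSwinnertonDyer.Theses.PrintX6 (PublishedInputsX6)
open Summit.BirchSwinnertonDyer.Rank1Residual.Supersingular
  (HasErratumPrime HasInertPair HasInertPairPrimeToUnits HasOddErratumPrime PublishedAcInputsX6ErrOdd PublishedAcInputsX6PairGuard
    missingPPartAt_of_upper_of_nonUnit analyticRank_eq_zero_of_LOneBall)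

namespace Summit.BirchSwinnertonDyer.Rank1Residual.X6.PrintCert

/-! ### §0 The Named bridge: ty2's `HasInertPairPrimeToUnits` decided per record -/

namespace Record

variable (r : Record)

/-- **`HasInertPairPrimeToUnits W p` for a certified record with the narrowed certificate** — ty2's predicate (p578797) is by
definition the structural statement of `exists_inertPairCoprime_of_check` (p574374). [cite: SilvermanAEC2009, VII.5 Prop. 5.1(b)] -/
theorem hasInertPairPrimeToUnits_of_check (hc : r.check = true) [r.curve.IsElliptic] [r.curve.IsGloballyMinimal]
    (h : r.inertPairCoprimeAt = true) : HasInertPairPrimeToUnits r.curve r.p :=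
  r.exists_inertPairCoprime_of_check hc h

/-- **`¬ HasInertPairPrimeToUnits W p` for a certified record without the certificate.** [cite: SilvermanAEC2009, VII.5 Prop. 5.1(a) and (b)] -/
theorem not_hasInertPairPrimeToUnits_of_check (hc : r.check = true) [r.curve.IsElliptic] [r.curve.IsGloballyMinimal]
    (h : r.inertPairCoprimeAt = false) : ¬ HasInertPairPrimeToUnits r.curve r.p :=
  r.not_exists_inertPairCoprime_of_check hc h

end Record

/-- **`HasInertPairPrimeToUnits` is DECIDED on the display**: for a listed record, `↔ inertPairCoprimeAt` (103 of 113 at `p ≥ 5`,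
p574374 `inertPairCoprime_counts_allRecords`; 27/27 at `p ≥ 7`). [cite: SilvermanAEC2009, VII.5 Prop. 5.1(a) and (b)] -/
theorem hasInertPairPrimeToUnits_iff_of_mem (r : Record) (hr : r ∈ allRecords) :
    haveI := (r.elliptic_and_minimal_of_check (check_of_mem_of_certified certified_allRecords hr)).1
    haveI := (r.elliptic_and_minimal_of_check (check_of_mem_of_certified certified_allRecords hr)).2
    HasInertPairPrimeToUnits r.curve r.p ↔ r.inertPairCoprimeAt = true :=
  exists_inertPairCoprime_iff_of_mem r hr

/-! ### §1 Pair level: the socket over the route's pack and the guarded pair pack -/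

/-- **`BSD(E,p)` on the narrowed inert-pair sub-locus over `PublishedInputsX6 ∧ PublishedAcInputsX6PairGuard`, by name**: upper
half = the route's PROVED `UpperHalfX6`; lower half on the non-unit value = p1's `eisensteinHalfFiveLe_inertPairGuard_of_facts` at the
witness pair (`¬ CM` by `ClassX6.not_hasCM`); value-cell split `missingPPartAt_of_upper_of_nonUnit`; `bsdp_of_missingPPartAt` with GZK.
No `HasErratumPrime` case split. CONDITIONAL on both conjunctions. [cite: Kobayashi2003, Thm. 1.2 (p. 2) and Thm. 4.1 (p. 8)]
[cite: BDKim2013, Cor. 3.15 (p. 199)] [cite: CastellaWan2023, Thm. 5.3 and Prop. 2.7] [cite: Miller2011LMS, §1 and Def. 1.1] -/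
theorem bsdp_of_publishedInputsX6_of_publishedAcInputsX6PairGuard_of_hasInertPairPrimeToUnits (hPub : PublishedInputsX6)
    (hAcG : PublishedAcInputsX6PairGuard) (W : WeierstrassCurve ℚ) [W.IsElliptic] [W.IsGloballyMinimal] (p : ℕ) [Fact p.Prime]
    (h5 : 5 ≤ p) (hX : ClassX6 W p) (h0 : W.analyticRank = 0) (hP : HasInertPairPrimeToUnits W p) : BSDp W p := by
  obtain ⟨hSh, hFH, hJL, hRT, h23, hK13, hGZK, hnf, hMaz⟩ := hAcG
  obtain ⟨ℓ₁, ℓ₂, i₁, i₂, hne, h₁, h₂, hr₁, hr₂, hu⟩ := hP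
  exact bsdp_of_missingPPartAt W p hPub.2.2.2.2.2.2.2.2 (by omega)
    (missingPPartAt_of_upper_of_nonUnit W p
      (Summit.BirchSwinnertonDyer.BirchSwinnertonDyer.Theorems.upperHalfX6_proof hPub W p (by omega) hX h0)
      (Summit.BirchSwinnertonDyer.BirchSwinnertonDyer.Theorems.AnticyclotomicRankZero.eisensteinHalfFiveLe_inertPairGuard_of_facts
        hSh hFH hJL hRT h23 hK13 hGZK hnf hMaz W p (ClassX6.not_hasCM W hX) h5 hX h0 ℓ₁ ℓ₂ hne h₁ h₂ hr₁ hr₂ hu))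

/-! ### §2 Per record -/

namespace Record

variable (r : Record) [Fact r.p.Prime] [r.curve.IsElliptic] [r.curve.IsGloballyMinimal]

/-- **GUARDED-PAIR road (no open crux, no identification rider).** For a certified record at `p ≥ 5` with the narrowed certificate
whose claim holds: `BSD(E,p)` over `PublishedInputsX6 ∧ PublishedAcInputsX6PairGuard`. What each of the 103 narrowed-pair census cells at
`p ≥ 5` inherits. [cite: Kobayashi2003, Thm. 1.2 (p. 2) and Thm. 4.1 (p. 8)] [cite: BDKim2013, Cor. 3.15 (p. 199)]
[cite: SilvermanAEC2009, VII.5 Prop. 5.1(b)] [cite: Miller2011LMS, §1 and Def. 1.1] -/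
theorem bsdp_of_inertPairCoprimeAt (hPub : PublishedInputsX6) (hAcG : PublishedAcInputsX6PairGuard) (hc : r.check = true)
    (h : r.Claim) (h5 : 5 ≤ r.p) (hP : r.inertPairCoprimeAt = true) : BSDp r.curve r.p :=
  bsdp_of_publishedInputsX6_of_publishedAcInputsX6PairGuard_of_hasInertPairPrimeToUnits hPub hAcG r.curve r.p h5
    (r.classX6_of_check hc) h.1 (r.hasInertPairPrimeToUnits_of_check hc hP)

/-- **GUARDED-PAIR road, claim-free** (the record's own level-one enclosure line; targets p560348). [cite: Kobayashi2003, Thm. 1.2 and Thm. 4.1]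
[cite: BDKim2013, Cor. 3.15 (p. 199)] [cite: BirchSwinnertonDyer1965] [cite: MazurTateTeitelbaum1986Invent, §I.8] [cite: Miller2011LMS, Def. 1.1] -/
theorem bsdp_of_inertPairCoprimeAt_of_LOneBall (hPub : PublishedInputsX6) (hAcG : PublishedAcInputsX6PairGuard) (hc : r.check = true)
    (h5 : 5 ≤ r.p) (hP : r.inertPairCoprimeAt = true) {N : ℕ} [NeZero N] (f : CuspForm (Gamma0 N) 2)
    (hball0 : ∃ mid rad : ℝ, rad ≤ 1 / 10 ^ (20 : ℕ) ∧ |mid - (((r.encI : ℕ) : ℤ) : ℝ)| ≤ 1 / 10 ^ (20 : ℕ) ∧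
      |((r.encDen : ℕ) : ℝ) * (((r.cInf : ℕ) : ℝ) * ((r.curve.entireLFunction 1).re / plusPeriod f)) - mid| ≤ rad) :
    BSDp r.curve r.p :=
  bsdp_of_publishedInputsX6_of_publishedAcInputsX6PairGuard_of_hasInertPairPrimeToUnits hPub hAcG r.curve r.p h5
    (r.classX6_of_check hc) (r.analyticRank_eq_zero_of_LOneBall hc f hball0) (r.hasInertPairPrimeToUnits_of_check hc hP)

/-- **Either refined key** (the kernel's union road): a certified record at `p ≥ 5` with the odd-erratum OR the narrowed-pair
certificate, claim holding, gets `BSD(E,p)` over `PublishedInputsX6 ∧ PublishedAcInputsX6ErrOdd ∧ PublishedAcInputsX6PairGuard`.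
[cite: Kobayashi2003, Thm. 1.2 and Thm. 4.1] [cite: BDKim2013, Cor. 3.15 (p. 199)] [cite: Miller2011LMS, §1 and Def. 1.1] -/
theorem bsdp_of_errOddAt_or_inertPairCoprimeAt (hPub : PublishedInputsX6) (hAcO : PublishedAcInputsX6ErrOdd)
    (hAcG : PublishedAcInputsX6PairGuard) (hc : r.check = true) (h : r.Claim) (h5 : 5 ≤ r.p)
    (hk : r.errOddAt = true ∨ r.inertPairCoprimeAt = true) : BSDp r.curve r.p := by
  rcases hk with he | hP
  · exact r.bsdp_of_errOddAt hPub hAcO hc h h5 he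
  · exact r.bsdp_of_inertPairCoprimeAt hPub hAcG hc h h5 hP

end Record

/-! ### §3 The census over `allRecords`: 103 by this road, 111 of 113 by the two refined roads, the residual on two records -/

section Lists

variable {rs : List Record}

/-- **GUARDED-PAIR road, list form, instance-free.** [cite: Kobayashi2003, Thm. 1.2 and Thm. 4.1] [cite: BDKim2013, Cor. 3.15 (p. 199)]
[cite: Miller2011LMS, §1 and Def. 1.1] -/
theorem bsdp_of_certified_of_claims_of_inertPairCoprimeAt (hPub : PublishedInputsX6) (hAcG : PublishedAcInputsX6PairGuard)
    (hC : certified rs = true) (hcl : Claims rs) (r : Record) (hr : r ∈ rs) (h5 : 5 ≤ r.p) (hP : r.inertPairCoprimeAt = true) :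
    haveI := r.fact_prime_of_check (check_of_mem_of_certified hC hr)
    haveI := (r.elliptic_and_minimal_of_check (check_of_mem_of_certified hC hr)).1
    haveI := (r.elliptic_and_minimal_of_check (check_of_mem_of_certified hC hr)).2
    BSDp r.curve r.p := by
  have hc := check_of_mem_of_certified hC hr
  haveI := r.fact_prime_of_check hc
  haveI := (r.elliptic_and_minimal_of_check hc).1
  haveI := (r.elliptic_and_minimal_of_check hc).2
  exact r.bsdp_of_inertPairCoprimeAt hPub hAcG hc (hcl r hr) h5 hP

/-- **Both refined roads, list form, instance-free.** [cite: Kobayashi2003, Thm. 1.2 and Thm. 4.1] [cite: Miller2011LMS, §1 and Def. 1.1] -/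
theorem bsdp_of_certified_of_claims_of_errOddAt_or_inertPairCoprimeAt (hPub : PublishedInputsX6)
    (hAcO : PublishedAcInputsX6ErrOdd) (hAcG : PublishedAcInputsX6PairGuard) (hC : certified rs = true) (hcl : Claims rs)
    (r : Record) (hr : r ∈ rs) (h5 : 5 ≤ r.p) (hk : r.errOddAt = true ∨ r.inertPairCoprimeAt = true) :
    haveI := r.fact_prime_of_check (check_of_mem_of_certified hC hr)
    haveI := (r.elliptic_and_minimal_of_check (check_of_mem_of_certified hC hr)).1
    haveI := (r.elliptic_and_minimal_of_check (check_of_mem_of_certified hC hr)).2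
    BSDp r.curve r.p := by
  have hc := check_of_mem_of_certified hC hr
  haveI := r.fact_prime_of_check hc
  haveI := (r.elliptic_and_minimal_of_check hc).1
  haveI := (r.elliptic_and_minimal_of_check hc).2
  exact r.bsdp_of_errOddAt_or_inertPairCoprimeAt hPub hAcO hAcG hc (hcl r hr) h5 hk

end Lists

/-- **The 103 narrowed-pair census cells at `p ≥ 5`: `BSD(E,p)` by name with NO open crux and NO identification rider** — over
`PublishedInputsX6 ∧ PublishedAcInputsX6PairGuard` and the records' claims (`inertPairCoprime_counts_allRecords`: 103 of 113; Err 99,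
Rest 4; 76/86 @ 5, 27/27 @ 7–13). Tier: the referee's β3 word. [cite: Kobayashi2003, Thm. 1.2 and Thm. 4.1]
[cite: BDKim2013, Cor. 3.15 (p. 199)] [cite: Miller2011LMS, §1 and Def. 1.1] -/
theorem bsdp_of_mem_inertPairCoprimeAt (hPub : PublishedInputsX6) (hAcG : PublishedAcInputsX6PairGuard) (hcl : Claims allRecords)
    (r : Record) (hr : r ∈ allRecords) (h5 : 5 ≤ r.p) (hP : r.inertPairCoprimeAt = true) :
    haveI := r.fact_prime_of_check (check_of_mem_of_certified certified_allRecords hr)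
    haveI := (r.elliptic_and_minimal_of_check (check_of_mem_of_certified certified_allRecords hr)).1
    haveI := (r.elliptic_and_minimal_of_check (check_of_mem_of_certified certified_allRecords hr)).2
    BSDp r.curve r.p :=
  bsdp_of_certified_of_claims_of_inertPairCoprimeAt hPub hAcG certified_allRecords hcl r hr h5 hP

/-- **111 of the 113 census cells at `p ≥ 5` — every listed record at `p ≥ 5` other than `246697a1, 321518d1 @ 5` — get `BSD(E,p)`
BY NAME over `PublishedInputsX6 ∧ PublishedAcInputsX6ErrOdd ∧ PublishedAcInputsX6PairGuard`** (the two refined class keys of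
children5 v2), with NO open crux: the certificate disjunction is p577965/`errOddAt_or_inertPairCoprimeAt_of_mem_five_le`.
[cite: Kobayashi2003, Thm. 1.2 and Thm. 4.1] [cite: BDKim2013, Cor. 3.15 (p. 199)] [cite: Miller2011LMS, §1 and Def. 1.1] -/
theorem bsdp_of_mem_five_le_of_label_ne (hPub : PublishedInputsX6) (hAcO : PublishedAcInputsX6ErrOdd)
    (hAcG : PublishedAcInputsX6PairGuard) (hcl : Claims allRecords) (r : Record) (hr : r ∈ allRecords) (h5 : 5 ≤ r.p)
    (hne : r.label ≠ "246697a1" ∧ r.label ≠ "321518d1") :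
    haveI := r.fact_prime_of_check (check_of_mem_of_certified certified_allRecords hr)
    haveI := (r.elliptic_and_minimal_of_check (check_of_mem_of_certified certified_allRecords hr)).1
    haveI := (r.elliptic_and_minimal_of_check (check_of_mem_of_certified certified_allRecords hr)).2
    BSDp r.curve r.p :=
  bsdp_of_certified_of_claims_of_errOddAt_or_inertPairCoprimeAt hPub hAcO hAcG certified_allRecords hcl r hr h5
    (errOddAt_or_inertPairCoprimeAt_of_mem_five_le r hr h5 hne)

/-- **The open-crux count of the census under children5 v2** (kernel recount): at `p ≥ 5`, 111 records carry a PRINT-candidate key's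
certificate (odd erratum ∪ narrowed pair), 2 carry neither and have the Rest certificate (the refined residual `RestThinGuard`), and
the 621 records at `p = 3` wait on `EisensteinHalfAtThree`; 734 in all. [folklore] -/
theorem openCrux_count_v2_allRecords :
    (allRecords.filter fun r => 5 ≤ r.p ∧ (r.errOddAt || r.inertPairCoprimeAt) = true).length = 111 ∧
    (allRecords.filter fun r => 5 ≤ r.p ∧ r.errOddAt = false ∧ r.inertPairCoprimeAt = false).length = 2 ∧
    (allRecords.filter fun r => r.p = 3).length = 621 ∧ allRecords.length = 734 :=
  ⟨errOdd_or_inertPairCoprime_counts_five_le.1, by decide +kernel, count_allRecords.2.1, count_allRecords.1⟩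

/-! ### §4 `hWeq` adapters, the refined residual's two records, and the cells by name -/

section Adapters

variable {rs : List Record} {W : WeierstrassCurve ℚ} [W.IsElliptic] [W.IsGloballyMinimal]
  {a1 a2 a3 a4 a6 : ℤ} {p : ℕ} [Fact p.Prime]

omit [Fact p.Prime] in
/-- **`HasInertPairPrimeToUnits W p` in the `hWeq` shape.** [cite: SilvermanAEC2009, VII.5 Prop. 5.1(b)] -/
theorem hasInertPairPrimeToUnits_of_exists (hrs : certified rs = true)
    (h : ∃ r ∈ rs, r.ainvs = [a1, a2, a3, a4, a6] ∧ r.p = p ∧ r.inertPairCoprimeAt = true)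
    (hWeq : W = ⟨a1, a2, a3, a4, a6⟩) : HasInertPairPrimeToUnits W p :=
  exists_inertPairCoprime_of_exists hrs h hWeq

omit [Fact p.Prime] in
/-- **`¬ HasInertPairPrimeToUnits W p` in the `hWeq` shape.** [cite: SilvermanAEC2009, VII.5 Prop. 5.1(a) and (b)] -/
theorem not_hasInertPairPrimeToUnits_of_exists (hrs : certified rs = true)
    (h : ∃ r ∈ rs, r.ainvs = [a1, a2, a3, a4, a6] ∧ r.p = p ∧ r.inertPairCoprimeAt = false)
    (hWeq : W = ⟨a1, a2, a3, a4, a6⟩) : ¬ HasInertPairPrimeToUnits W p :=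
  not_exists_inertPairCoprime_of_exists hrs h hWeq

/-- **`BSD(E,p)` at a narrowed-pair cell in the `hWeq` shape** (any of the 103): over `PublishedInputsX6 ∧ PublishedAcInputsX6PairGuard`
and an explicit `r_an = 0`. [cite: Kobayashi2003, Thm. 1.2 and Thm. 4.1] [cite: BDKim2013, Cor. 3.15 (p. 199)]
[cite: SilvermanAEC2009, VII.5 Prop. 5.1(b)] [cite: Miller2011LMS, §1 and Def. 1.1] -/
theorem bsdp_of_exists_inertPairCoprimeAt (hrs : certified rs = true)
    (h : ∃ r ∈ rs, r.ainvs = [a1, a2, a3, a4, a6] ∧ r.p = p ∧ r.inertPairCoprimeAt = true)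
    (hWeq : W = ⟨a1, a2, a3, a4, a6⟩) (hPub : PublishedInputsX6) (hAcG : PublishedAcInputsX6PairGuard) (h5 : 5 ≤ p)
    (h0 : W.analyticRank = 0) : BSDp W p := by
  obtain ⟨r, hr, hA, hp, hP⟩ := h
  have hc := check_of_mem_of_certified hrs hr
  have hW : W = r.curve := by rw [hWeq]; exact r.curve_eq hA
  subst hW
  subst hp
  exact bsdp_of_publishedInputsX6_of_publishedAcInputsX6PairGuard_of_hasInertPairPrimeToUnits hPub hAcG r.curve r.p h5
    (r.classX6_of_check hc) h0 (r.hasInertPairPrimeToUnits_of_check hc hP)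

/-- **`BSD(E,p)` at a narrowed-pair cell from the packs and the cell files' LEVEL-ONE ENCLOSURE LINE, verbatim** (`I ≠ 0`, `R + Mr < 1`).
[cite: Kobayashi2003, Thm. 1.2 and Thm. 4.1] [cite: BirchSwinnertonDyer1965] [cite: MazurTateTeitelbaum1986Invent, §I.8] [cite: Miller2011LMS, Def. 1.1] -/
theorem bsdp_of_exists_inertPairCoprimeAt_of_LOneBall (hrs : certified rs = true)
    (h : ∃ r ∈ rs, r.ainvs = [a1, a2, a3, a4, a6] ∧ r.p = p ∧ r.inertPairCoprimeAt = true)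
    (hWeq : W = ⟨a1, a2, a3, a4, a6⟩) (hPub : PublishedInputsX6) (hAcG : PublishedAcInputsX6PairGuard) (h5 : 5 ≤ p)
    {N : ℕ} [NeZero N] (f : CuspForm (Gamma0 N) 2) (R Mr den c : ℝ) (I : ℤ) (hI : I ≠ 0) (hsmall : R + Mr < 1)
    (hball0 : ∃ mid rad : ℝ, rad ≤ R ∧ |mid - ((I : ℤ) : ℝ)| ≤ Mr ∧
      |den * (c * ((W.entireLFunction 1).re / plusPeriod f)) - mid| ≤ rad) :
    BSDp W p :=
  bsdp_of_exists_inertPairCoprimeAt hrs h hWeq hPub hAcG h5 (analyticRank_eq_zero_of_LOneBall f R Mr den c I hI hsmall hball0)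

end Adapters

section Cells

variable {W : WeierstrassCurve ℚ} [W.IsElliptic] [W.IsGloballyMinimal]

/-- **The refined residual's first record `246697a1 @ 5`**: `¬ HasErratumPrime W 5 ∧ ¬ HasInertPairPrimeToUnits W 5` — both
hypotheses of children5 v2's `RestThinGuard` hold here (all bad primes `11, 41, 547` split; `11 ≡ 41 ≡ 1 (mod 5)`), so neither refined
key reaches this cell (it is PROVED per pair on the director's book by another road). [cite: Cremona2006, Table 1 (246697a1)] -/
theorem restThinGuard_hyps_cell_246697a1_at5 (hWeq : W = ⟨0, 0, 1, -292934695, -1929764585205⟩) :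
    ¬ HasErratumPrime W 5 ∧ ¬ HasInertPairPrimeToUnits W 5 :=
  ⟨not_hasErratumPrime_of_exists certified_records14 (by decide +kernel) hWeq,
    not_hasInertPairPrimeToUnits_of_exists certified_records14 (by decide +kernel) hWeq⟩

/-- **The refined residual's second record `321518d1 @ 5`** (bad `2, 19, 8461` all split; `19 ≡ −1`, `8461 ≡ 1 (mod 5)`):
`¬ HasErratumPrime W 5 ∧ ¬ HasInertPairPrimeToUnits W 5`. [cite: Cremona2006, Table 1 (321518d1)] -/
theorem restThinGuard_hyps_cell_321518d1_at5 (hWeq : W = ⟨1, 0, 0, -80858, -9082420⟩) :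
    ¬ HasErratumPrime W 5 ∧ ¬ HasInertPairPrimeToUnits W 5 :=
  ⟨not_hasErratumPrime_of_exists certified_records15 (by decide +kernel) hWeq,
    not_hasInertPairPrimeToUnits_of_exists certified_records15 (by decide +kernel) hWeq⟩

/-- Rest keeper `138594b1 @ 5` (narrowed pair `(2, 3)`): `BSD(E,5)` over `PublishedInputsX6 ∧ PublishedAcInputsX6PairGuard` and `r_an = 0`.
[cite: Cremona2006, Table 1 (138594b1)] [cite: Miller2011LMS, §1 and Def. 1.1] -/
theorem bsdp_cell_138594b1_at5_of_publishedInputsX6_of_publishedAcInputsX6PairGuard [Fact (Nat.Prime 5)]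
    (hWeq : W = ⟨1, 0, 0, -1443, -21219⟩) (hPub : PublishedInputsX6) (hAcG : PublishedAcInputsX6PairGuard)
    (h0 : W.analyticRank = 0) : BSDp W 5 :=
  bsdp_of_exists_inertPairCoprimeAt certified_records14 (by decide +kernel) hWeq hPub hAcG (by norm_num) h0

/-- Rest keeper `331554a1 @ 5` (narrowed pair `(2, 3)`). [cite: Cremona2006, Table 1 (331554a1)] -/
theorem bsdp_cell_331554a1_at5_of_publishedInputsX6_of_publishedAcInputsX6PairGuard [Fact (Nat.Prime 5)]
    (hWeq : W = ⟨1, 0, 0, -3453, -78387⟩) (hPub : PublishedInputsX6) (hAcG : PublishedAcInputsX6PairGuard)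
    (h0 : W.analyticRank = 0) : BSDp W 5 :=
  bsdp_of_exists_inertPairCoprimeAt certified_records15 (by decide +kernel) hWeq hPub hAcG (by norm_num) h0

/-- Rest keeper `12927e1 @ 7` (narrowed pair `(3, 31)`). [cite: Cremona2006, Table 1 (12927e1)] -/
theorem bsdp_cell_12927e1_at7_of_publishedInputsX6_of_publishedAcInputsX6PairGuard [Fact (Nat.Prime 7)]
    (hWeq : W = ⟨1, 0, 0, -42189461, -105479619702⟩) (hPub : PublishedInputsX6) (hAcG : PublishedAcInputsX6PairGuard)
    (h0 : W.analyticRank = 0) : BSDp W 7 :=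
  bsdp_of_exists_inertPairCoprimeAt certified_records16 (by decide +kernel) hWeq hPub hAcG (by norm_num) h0

/-- Rest keeper `399190l1 @ 7` (every bad prime `≢ ±1 (mod 7)`). [cite: Cremona2006, Table 1 (399190l1)] -/
theorem bsdp_cell_399190l1_at7_of_publishedInputsX6_of_publishedAcInputsX6PairGuard [Fact (Nat.Prime 7)]
    (hWeq : W = ⟨1, -1, 1, -8615202972, -2594053676135591⟩) (hPub : PublishedInputsX6) (hAcG : PublishedAcInputsX6PairGuard)
    (h0 : W.analyticRank = 0) : BSDp W 7 :=
  bsdp_of_exists_inertPairCoprimeAt certified_records16 (by decide +kernel) hWeq hPub hAcG (by norm_num) h0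

/-- `q = 2`-only Err record `65774b1 @ 5` (narrowed pair `(2, 32887)`; not reached by the odd-erratum road). [cite: Cremona2006, Table 1 (65774b1)] -/
theorem bsdp_cell_65774b1_at5_of_publishedInputsX6_of_publishedAcInputsX6PairGuard [Fact (Nat.Prime 5)]
    (hWeq : W = ⟨1, 1, 0, -2045, -80707⟩) (hPub : PublishedInputsX6) (hAcG : PublishedAcInputsX6PairGuard)
    (h0 : W.analyticRank = 0) : BSDp W 5 :=
  bsdp_of_exists_inertPairCoprimeAt certified_records14 (by decide +kernel) hWeq hPub hAcG (by norm_num) h0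

/-- `q = 2`-only Err record `145146q1 @ 5` (cell C4). [cite: Cremona2006, Table 1 (145146q1)] -/
theorem bsdp_cell_145146q1_at5_of_publishedInputsX6_of_publishedAcInputsX6PairGuard [Fact (Nat.Prime 5)]
    (hWeq : W = ⟨1, 0, 1, -3229945761, -70654953055340⟩) (hPub : PublishedInputsX6) (hAcG : PublishedAcInputsX6PairGuard)
    (h0 : W.analyticRank = 0) : BSDp W 5 :=
  bsdp_of_exists_inertPairCoprimeAt certified_records14 (by decide +kernel) hWeq hPub hAcG (by norm_num) h0

/-- `q = 2`-only Err record `220022c1 @ 5`. [cite: Cremona2006, Table 1 (220022c1)] -/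
theorem bsdp_cell_220022c1_at5_of_publishedInputsX6_of_publishedAcInputsX6PairGuard [Fact (Nat.Prime 5)]
    (hWeq : W = ⟨1, -1, 0, -766181797, -8161933796331⟩) (hPub : PublishedInputsX6) (hAcG : PublishedAcInputsX6PairGuard)
    (h0 : W.analyticRank = 0) : BSDp W 5 :=
  bsdp_of_exists_inertPairCoprimeAt certified_records14 (by decide +kernel) hWeq hPub hAcG (by norm_num) h0

/-- `q = 2`-only Err record `476882e1 @ 5`. [cite: Cremona2006, Table 1 (476882e1)] -/
theorem bsdp_cell_476882e1_at5_of_publishedInputsX6_of_publishedAcInputsX6PairGuard [Fact (Nat.Prime 5)]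
    (hWeq : W = ⟨1, 0, 1, 220814, 286977796⟩) (hPub : PublishedInputsX6) (hAcG : PublishedAcInputsX6PairGuard)
    (h0 : W.analyticRank = 0) : BSDp W 5 :=
  bsdp_of_exists_inertPairCoprimeAt certified_records15 (by decide +kernel) hWeq hPub hAcG (by norm_num) h0

/-- **The T3 witness cell `22678e1 @ 5`** (narrowed pair `(17, 23)`): `BSD(E,5)` over the two conjunctions and `r_an = 0`.
[cite: Cremona2006, Table 1 (22678e1)] [cite: Miller2011LMS, §1 and Def. 1.1] -/
theorem bsdp_cell_22678e1_at5_of_publishedInputsX6_of_publishedAcInputsX6PairGuard [Fact (Nat.Prime 5)]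
    (hWeq : W = ⟨1, 0, 0, 3140254662, -139987982322460⟩) (hPub : PublishedInputsX6) (hAcG : PublishedAcInputsX6PairGuard)
    (h0 : W.analyticRank = 0) : BSDp W 5 :=
  bsdp_of_exists_inertPairCoprimeAt certified_records14 (by decide +kernel) hWeq hPub hAcG (by norm_num) h0

end Cells

end Summit.BirchSwinnertonDyer.Rank1Residual.X6.PrintCert
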